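import Literature.RingTheory.MvPolynomial.HypersurfaceAsymptoticLine
import Mathlib.FieldTheory.Separable
import Mathlib.Algebra.Polynomial.Derivation
import Mathlib.RingTheory.Derivation.MapCoeffs
import Mathlib.RingTheory.AdjoinRoot
import HarnessLib

/-!
# The generic flecnodal line of a surface (algebraic core of the Monge–Salmon–Cayley theorem)

Topic `Literature/RingTheory/MvPolynomial`. Everything in this file is PROVED. Third layer of
the function-field treatment of a surface `S = {f = 0} ⊆ K³` (`f` irreducible of degree `d`,
`∂₂f ∉ (f)`, `k!` invertible in `K` for `k ≤ d`), after `HypersurfaceFunctionField.lean` (the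
graph derivations `D₀, D₁` of `L = K(S)`) and `HypersurfaceLineTaylor.lean` (the slope derivation
`𝒟 = D₀ + σD₁` of `L[σ]`, the osculating polynomials `T_k = 𝒟ᵏ z̄` and the Taylor identity
`f(x̄₀ + t, x̄₁ + σt, Σ T_k tᵏ/k!) ≡ 0 mod t^{N+1}`). The only field-theoretic input is the
separability of the irreducible factor `q` (automatic in characteristic `0`, and in
characteristic `p > d` because `deg q ≤ deg T₂ = 2`).

**Theorem** (`Hypersurface.aeval_flecnodalLine_eq_zero`). Let `q ∈ L[σ]` be an irreducible
(monic) common factor of the second and third osculating polynomials `T₂, T₃` ("the generic point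
of `S` is flecnodal, with flecnodal slope `s` = a root of `q`") which is not a repeated factor of
`T₂` (`q ∤ T₂'`: the flecnodal direction is a SIMPLE asymptotic direction — the non-parabolic
case). Then in `L'[t]`, `L' = L[σ]/(q) ∋ s`,

  `f(x̄₀ + t, x̄₁ + s t, z̄ + T₁(s) t) = 0`:

the line through the generic point `(x̄₀, x̄₁, z̄)` with direction `(1, s, T₁(s))` lies on the
surface. This is the heart of Monge's theorem "every point has a triple tangent line `⟹`
ruled" [Kollar2015, Thm. 13 and §6] in purely algebraic form: with the derivation
`D_s = D₀' + s D₁'` of `L'` (`Dₐ'` the unique extensions of `Dₐ`, `Derivation.adjoinRootDeriv`),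
one has `D_s(T_k(s)) = T_{k+1}(s) + T_k'(s) · D_s(s)` (`Ds_aeval`); `T₂(s) = T₃(s) = 0 ≠ T₂'(s)`
force `D_s(s) = 0`, hence `T_k(s) = 0` for all `k ≥ 2` (`aeval_root_osc_eq_zero`), and the
Taylor identity specialises to the vanishing of `f` on the line (degrees `≤ d` by the identity,
`> d` by a degree count).

What is NOT here (the remaining steps to [Kollar2015, Thm. 13]): the passage from the generic
line over `L'` to lines through the `K`-points of a dense open subset of `S` (specialisation),
the identification of "`T₂, T₃` have a common factor" with the vanishing of a flecnode
polynomial on `S`, and the parabolic case `q² ∣ T₂`.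

## References
* [Kollar2015] J. Kollár, *Szemerédi–Trotter-type theorems in dimension 3*, Adv. Math. 271
  (2015), Theorem 13 and §6.
-/

namespace Literature.RingTheory.MvPolynomial

open Polynomial Finset
open scoped Nat

/-! ### Coefficientwise derivations; extension of a derivation to a simple separable extension -/

section Coeffwise

variable {K F : Type*} [CommRing K] [CommRing F] [Algebra K F]

/-- Coefficientwise action of a derivation of `F` on `F[X]`. [folklore] -/
noncomputable def _root_.Derivation.coeffwise (D : Derivation K F F) : Derivation K F[X] F[X] :=
  PolynomialModule.equivPolynomialSelf.compDer D.mapCoeffs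

/-- `D.coeffwise` acts on coefficients. [folklore] -/
theorem _root_.Derivation.coeff_coeffwise (D : Derivation K F F) (p : F[X]) (i : ℕ) :
    (D.coeffwise p).coeff i = D (p.coeff i) := rfl

/-- `D.coeffwise (C a) = C (D a)`. [folklore] -/
theorem _root_.Derivation.coeffwise_C (D : Derivation K F F) (a : F) :
    D.coeffwise (C a) = C (D a) := by
  ext i
  rw [Derivation.coeff_coeffwise, coeff_C, coeff_C]
  split_ifs
  · rfl
  · exact map_zero D

/-- `D.coeffwise X = 0`. [folklore] -/
theorem _root_.Derivation.coeffwise_X (D : Derivation K F F) : D.coeffwise X = 0 := by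
  ext i
  rw [Derivation.coeff_coeffwise, coeff_X, coeff_zero]
  split_ifs
  · exact D.map_one_eq_zero
  · exact map_zero D

end Coeffwise

section AdjoinRootDeriv

variable {K F : Type*} [Field K] [Field F] [Algebra K F]
variable (q : F[X]) [Fact (Irreducible q)] [Fact q.Monic]

/-- The correction polynomial `v`, `v(s) = -q^D(s)/q'(s)` (the value forced for `D'(s)`).
[folklore] -/
noncomputable def _root_.Derivation.adjoinRootCorr (D : Derivation K F F) : F[X] :=
  AdjoinRoot.modByMonicHom (Fact.out : q.Monic)
    (-(AdjoinRoot.mk q (D.coeffwise q)) / aeval (AdjoinRoot.root q) (derivative q))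

/-- `v(s) = -q^D(s)/q'(s)`. [folklore] -/
theorem _root_.Derivation.mk_adjoinRootCorr (D : Derivation K F F) :
    AdjoinRoot.mk q (D.adjoinRootCorr q) =
      -(AdjoinRoot.mk q (D.coeffwise q)) / aeval (AdjoinRoot.root q) (derivative q) :=
  AdjoinRoot.mk_leftInverse (Fact.out : q.Monic) _

variable [Fact q.Separable]

omit [Fact q.Monic] in
/-- `q'(s) ≠ 0` for the root `s` of a separable `q`. [folklore] -/
theorem aeval_root_derivative_ne_zero : aeval (AdjoinRoot.root q) (derivative q) ≠ 0 :=
  (Fact.out : q.Separable).aeval_derivative_ne_zero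
    (by rw [AdjoinRoot.aeval_eq, AdjoinRoot.mk_self])

/-- The kernel `(q)` of `F[X] → F[X]/(q)` is stable under `D^cw + v • d/dX`. [folklore] -/
theorem _root_.Derivation.adjoinRootDeriv_aux (D : Derivation K F F) :
    ∀ x, (AdjoinRoot.mkₐ q).restrictScalars K x = 0 →
      (AdjoinRoot.mkₐ q).restrictScalars K ((D.coeffwise + D.adjoinRootCorr q •
        ((derivative' : Derivation F F[X] F[X]).restrictScalars K)) x) = 0 := by
  intro x hx
  change AdjoinRoot.mk q x = 0 at hx
  change AdjoinRoot.mk q _ = 0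
  rw [AdjoinRoot.mk_eq_zero] at hx
  obtain ⟨r, rfl⟩ := hx
  rw [Derivation.leibniz, smul_eq_mul, smul_eq_mul, map_add, map_mul, map_mul,
    AdjoinRoot.mk_self, zero_mul, zero_add, Derivation.add_apply, Derivation.smul_apply,
    Derivation.restrictScalars_apply, derivative'_apply, smul_eq_mul, map_add, map_mul,
    Derivation.mk_adjoinRootCorr, ← AdjoinRoot.aeval_eq (derivative q),
    div_mul_cancel₀ _ (aeval_root_derivative_ne_zero q), add_neg_cancel, mul_zero]

/-- **The extension of a derivation `D` of `F` to `F[X]/(q)`** (`q` irreducible, monic,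
separable): the derivation `p(s) ↦ p^D(s) + p'(s) v(s)` with `v(s) = -q^D(s)/q'(s)`
(as in Mathlib's `Differential (AdjoinRoot q)`, here for `K`-derivations and without
characteristic assumptions). [folklore] -/
noncomputable def _root_.Derivation.adjoinRootDeriv (D : Derivation K F F) :
    Derivation K (AdjoinRoot q) (AdjoinRoot q) :=
  Derivation.liftOfSurjective (f := (AdjoinRoot.mkₐ q).restrictScalars K) AdjoinRoot.mk_surjective
    (D.adjoinRootDeriv_aux q)

/-- `D'` on the class of a polynomial: `D'(p(s)) = p^D(s) + p'(s) D'(s)`. [folklore] -/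
theorem _root_.Derivation.adjoinRootDeriv_mk (D : Derivation K F F) (p : F[X]) :
    D.adjoinRootDeriv q (AdjoinRoot.mk q p) = AdjoinRoot.mk q (D.coeffwise p) +
      AdjoinRoot.mk q (derivative p) * D.adjoinRootDeriv q (AdjoinRoot.root q) := by
  have key : ∀ r : F[X], D.adjoinRootDeriv q (AdjoinRoot.mk q r) =
      AdjoinRoot.mk q (D.coeffwise r + D.adjoinRootCorr q * derivative r) :=
    fun r => Derivation.liftOfSurjective_apply (f := (AdjoinRoot.mkₐ q).restrictScalars K)
      AdjoinRoot.mk_surjective (D.adjoinRootDeriv_aux q) r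
  rw [key, ← AdjoinRoot.mk_X, key, Derivation.coeffwise_X, derivative_X, mul_one, zero_add,
    map_add, map_mul]
  ring

/-- `D'` restricts to `D` on `F`. [folklore] -/
theorem _root_.Derivation.adjoinRootDeriv_of (D : Derivation K F F) (a : F) :
    D.adjoinRootDeriv q (AdjoinRoot.of q a) = AdjoinRoot.of q (D a) := by
  rw [← AdjoinRoot.mk_C, Derivation.adjoinRootDeriv_mk, Derivation.coeffwise_C, derivative_C,
    map_zero, zero_mul, add_zero, AdjoinRoot.mk_C]

end AdjoinRootDeriv

/-! ### The flecnodal slope and the generic flecnodal line -/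

namespace Hypersurface

variable {K : Type*} [Field K] (f : MvPolynomial (Fin 3) K) [Fact (Irreducible f)]
  (q : Polynomial (FnField f)) [Fact (Irreducible q)] [Fact q.Monic] [Fact q.Separable]

/-- The extension `Dₐ'` of the graph derivation `Dₐ` to `L' = L[σ]/(q)`. [folklore] -/
noncomputable def extD (a : Fin 3) : Derivation K (AdjoinRoot q) (AdjoinRoot q) :=
  (gD f a).adjoinRootDeriv q

/-- The derivation `D_s = D₀' + s D₁'` of `L'` (`s` the class of `σ`, the flecnodal slope).
[folklore] -/
noncomputable def Ds : Derivation K (AdjoinRoot q) (AdjoinRoot q) :=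
  extD f q 0 + AdjoinRoot.root q • extD f q 1

/-- `cw` is `coeffwise`. [folklore] -/
theorem cw_eq_coeffwise (D : Derivation K (FnField f) (FnField f)) : cw f D = D.coeffwise := rfl

/-- `Dₐ'` on `P(s)`: `Dₐ'(P(s)) = (cw Dₐ P)(s) + P'(s) Dₐ'(s)`. [folklore] -/
theorem extD_aeval (a : Fin 3) (P : Polynomial (FnField f)) :
    extD f q a (aeval (AdjoinRoot.root q) P) = aeval (AdjoinRoot.root q) (cw f (gD f a) P) +
      aeval (AdjoinRoot.root q) (derivative P) * extD f q a (AdjoinRoot.root q) := by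
  rw [AdjoinRoot.aeval_eq, AdjoinRoot.aeval_eq, AdjoinRoot.aeval_eq, extD,
    Derivation.adjoinRootDeriv_mk, cw_eq_coeffwise]

/-- **The slope derivation under specialisation `σ ↦ s`**:
`D_s(P(s)) = (𝒟 P)(s) + P'(s) · D_s(s)`. [folklore] -/
theorem Ds_aeval (P : Polynomial (FnField f)) :
    Ds f q (aeval (AdjoinRoot.root q) P) = aeval (AdjoinRoot.root q) (slopeDeriv f P) +
      aeval (AdjoinRoot.root q) (derivative P) * Ds f q (AdjoinRoot.root q) := by
  have hsl : slopeDeriv f P = cw f (gD f 0) P + X * cw f (gD f 1) P := by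
    rw [slopeDeriv, Derivation.add_apply, Derivation.smul_apply, smul_eq_mul]
  rw [Ds, Derivation.add_apply, Derivation.smul_apply, Derivation.add_apply,
    Derivation.smul_apply, extD_aeval, extD_aeval, hsl, map_add, map_mul, aeval_X, smul_eq_mul,
    smul_eq_mul]
  ring

/-- `Dₐ'` restricts to `Dₐ` on `L`. [folklore] -/
theorem extD_algebraMap (a : Fin 3) (u : FnField f) :
    extD f q a (algebraMap (FnField f) (AdjoinRoot q) u) =
      algebraMap (FnField f) (AdjoinRoot q) (gD f a u) := by
  rw [AdjoinRoot.algebraMap_eq]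
  exact Derivation.adjoinRootDeriv_of q (gD f a) u

/-- `D_s` restricts to `D₀ + s D₁` on `L`. [folklore] -/
theorem Ds_algebraMap (u : FnField f) :
    Ds f q (algebraMap (FnField f) (AdjoinRoot q) u) =
      1 * algebraMap (FnField f) (AdjoinRoot q) (gD f 0 u) +
        AdjoinRoot.root q * algebraMap (FnField f) (AdjoinRoot q) (gD f 1 u) := by
  rw [Ds, Derivation.add_apply, Derivation.smul_apply, extD_algebraMap, extD_algebraMap,
    smul_eq_mul, one_mul]

/-- **Flecnodal and non-parabolic `⟹` the slope is constant along itself**: if `q ∣ T₂`,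
`q ∣ T₃` and `q ∤ T₂'` then `D_s(s) = 0`. [folklore] -/
theorem Ds_root_eq_zero (hq2 : q ∣ osc f 2) (hq3 : q ∣ osc f 3)
    (hnp : ¬ q ∣ derivative (osc f 2)) : Ds f q (AdjoinRoot.root q) = 0 := by
  have h2 : aeval (AdjoinRoot.root q) (osc f 2) = 0 := by
    rw [AdjoinRoot.aeval_eq, AdjoinRoot.mk_eq_zero]; exact hq2
  have h3 : aeval (AdjoinRoot.root q) (osc f 3) = 0 := by
    rw [AdjoinRoot.aeval_eq, AdjoinRoot.mk_eq_zero]; exact hq3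
  have h2' : aeval (AdjoinRoot.root q) (derivative (osc f 2)) ≠ 0 := by
    rw [Ne, AdjoinRoot.aeval_eq, AdjoinRoot.mk_eq_zero]; exact hnp
  have h := Ds_aeval f q (osc f 2)
  rw [← osc_succ, h2, h3, map_zero, zero_add] at h
  exact (mul_eq_zero.1 h.symm).resolve_left h2'

/-- **Flecnodal and non-parabolic `⟹` the slope is `D_s`-constant and all osculating
polynomials vanish at `s`**: if `q ∣ T₂`, `q ∣ T₃` and `q ∤ T₂'`, then `T_k(s) = 0` for every
`k ≥ 2`. [folklore] -/
theorem aeval_root_osc_eq_zero (hq2 : q ∣ osc f 2) (hq3 : q ∣ osc f 3)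
    (hnp : ¬ q ∣ derivative (osc f 2)) {k : ℕ} (hk : 2 ≤ k) :
    aeval (AdjoinRoot.root q) (osc f k) = 0 := by
  have h2 : aeval (AdjoinRoot.root q) (osc f 2) = 0 := by
    rw [AdjoinRoot.aeval_eq, AdjoinRoot.mk_eq_zero]; exact hq2
  have hDs : Ds f q (AdjoinRoot.root q) = 0 := Ds_root_eq_zero f q hq2 hq3 hnp
  -- induction from `k = 2`
  obtain ⟨m, rfl⟩ := Nat.exists_eq_add_of_le' hk
  induction m with
  | zero => exact h2
  | succ m ih =>
    have h := Ds_aeval f q (osc f (m + 2))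
    rw [← osc_succ, ih (by omega), map_zero, hDs, mul_zero, add_zero] at h
    rw [show m + 1 + 2 = m + 2 + 1 by ring]
    exact h.symm

/-! #### The specialisation `θ = map (mk q) : L[σ][t] → L'[t]` -/

omit [Fact q.Monic] [Fact q.Separable] in
/-- `θ (C P) = C (P(s))`. [folklore] -/
private theorem mapMk_C (P : Polynomial (FnField f)) :
    Polynomial.mapRingHom (AdjoinRoot.mk q) (C P) = C (AdjoinRoot.mk q P) := by
  rw [Polynomial.coe_mapRingHom, Polynomial.map_C]

omit [Fact q.Monic] [Fact q.Separable] in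
/-- `θ t = t`. [folklore] -/
private theorem mapMk_X :
    Polynomial.mapRingHom (AdjoinRoot.mk q) (X : Polynomial (Polynomial (FnField f))) = X := by
  rw [Polynomial.coe_mapRingHom, Polynomial.map_X]

omit [Fact (Irreducible q)] [Fact q.Monic] [Fact q.Separable] in
/-- The class of a constant is its image under the structure map. [folklore] -/
private theorem mk_C_eq_algebraMap (a : FnField f) :
    AdjoinRoot.mk q (C a) = algebraMap (FnField f) (AdjoinRoot q) a := by
  rw [AdjoinRoot.mk_C, AdjoinRoot.algebraMap_eq]

omit [Fact q.Monic] [Fact q.Separable] in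
/-- `mk q` is `K`-linear. [folklore] -/
private theorem mk_smul (c : K) (P : Polynomial (FnField f)) :
    AdjoinRoot.mk q (c • P) = c • AdjoinRoot.mk q P :=
  map_smul ((AdjoinRoot.mkₐ q).restrictScalars K) c P

/-- The image of the Taylor series `Σ_k T_k(σ) tᵏ/k!` under `σ ↦ s` is `z̄ + T₁(s) t`
(all `T_k(s)`, `k ≥ 2`, vanish). [folklore] -/
theorem mapMk_taylorSum (hq2 : q ∣ osc f 2) (hq3 : q ∣ osc f 3)
    (hnp : ¬ q ∣ derivative (osc f 2)) (N : ℕ) (hN1 : 1 ≤ N) :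
    Polynomial.mapRingHom (AdjoinRoot.mk q)
        (∑ k ∈ range (N + 1), C (((k ! : ℕ) : K)⁻¹ • osc f k) * X ^ k) =
      C (algebraMap (FnField f) (AdjoinRoot q) (toFn f (MvPolynomial.X 2))) +
        C (aeval (AdjoinRoot.root q) (osc f 1)) * X := by
  rw [map_sum, Finset.sum_eq_add_sum_sdiff_singleton_of_mem (mem_range.2 (by omega : 0 < N + 1)),
    Finset.sum_eq_add_sum_sdiff_singleton_of_mem (show 1 ∈ range (N + 1) \ {0} by simp; omega)]
  have hrest : ∑ k ∈ (range (N + 1) \ {0}) \ {1},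
      Polynomial.mapRingHom (AdjoinRoot.mk q) (C (((k ! : ℕ) : K)⁻¹ • osc f k) * X ^ k) = 0 := by
    refine Finset.sum_eq_zero fun k hk => ?_
    simp only [mem_sdiff, mem_range, mem_singleton] at hk
    rw [map_mul, mapMk_C, mk_smul, ← AdjoinRoot.aeval_eq,
      aeval_root_osc_eq_zero f q hq2 hq3 hnp (by omega), smul_zero, C_0, zero_mul]
  rw [hrest, add_zero, map_mul, map_mul, map_pow, map_pow, mapMk_C, mapMk_C, mapMk_X, mk_smul,
    mk_smul, osc_zero, mk_C_eq_algebraMap, ← AdjoinRoot.aeval_eq]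
  simp

/-- `θ` maps the Step A polynomial `P(x̄₀ + t, x̄₁ + σt, Σ T_k tᵏ/k!)` to the line polynomial
`P(x̄₀ + t, x̄₁ + s t, z̄ + T₁(s) t)`. [folklore] -/
theorem mapMk_aeval_lineTaylor (hq2 : q ∣ osc f 2) (hq3 : q ∣ osc f 3)
    (hnp : ¬ q ∣ derivative (osc f 2)) (N : ℕ) (hN1 : 1 ≤ N) (P : MvPolynomial (Fin 3) K) :
    Polynomial.mapRingHom (AdjoinRoot.mk q) (MvPolynomial.aeval
      ![C (C (toFn f (MvPolynomial.X 0))) + (X : Polynomial (Polynomial (FnField f))),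
        C (C (toFn f (MvPolynomial.X 1))) + C X * X,
        ∑ k ∈ range (N + 1), C (((k ! : ℕ) : K)⁻¹ • osc f k) * X ^ k] P) =
    MvPolynomial.aeval
      ![C (algebraMap (FnField f) (AdjoinRoot q) (toFn f (MvPolynomial.X 0))) + X,
        C (algebraMap (FnField f) (AdjoinRoot q) (toFn f (MvPolynomial.X 1))) +
          C (AdjoinRoot.root q) * X,
        C (algebraMap (FnField f) (AdjoinRoot q) (toFn f (MvPolynomial.X 2))) +
          C (aeval (AdjoinRoot.root q) (osc f 1)) * X] P := by
  induction P using MvPolynomial.induction_on with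
  | C a =>
    rw [MvPolynomial.algHom_C, MvPolynomial.algHom_C, Polynomial.algebraMap_apply,
      Polynomial.algebraMap_apply, Polynomial.algebraMap_apply, mapMk_C, mk_C_eq_algebraMap,
      ← IsScalarTower.algebraMap_apply]
  | add p₁ p₂ h₁ h₂ => rw [map_add, map_add, h₁, h₂, map_add]
  | mul_X p₁ i h₁ =>
    rw [map_mul, map_mul, map_mul, h₁, MvPolynomial.aeval_X, MvPolynomial.aeval_X]
    congr 1
    match i with
    | 0 =>
      simp only [Matrix.cons_val_zero]
      rw [map_add, mapMk_C, mapMk_X, mk_C_eq_algebraMap]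
    | 1 =>
      simp only [Matrix.cons_val_one, Matrix.cons_val_zero]
      rw [map_add, map_mul, mapMk_C, mapMk_C, mapMk_X, mk_C_eq_algebraMap, AdjoinRoot.mk_X]
    | 2 =>
      simp only [Matrix.cons_val]
      exact mapMk_taylorSum f q hq2 hq3 hnp N hN1

omit [Fact q.Monic] [Fact q.Separable] in
/-- The entries of the flecnodal line have degree `≤ 1` in `t`. [folklore] -/
theorem natDegree_flecnodalLine_le (i : Fin 3) :
    (![C (algebraMap (FnField f) (AdjoinRoot q) (toFn f (MvPolynomial.X 0))) + X,
        C (algebraMap (FnField f) (AdjoinRoot q) (toFn f (MvPolynomial.X 1))) +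
          C (AdjoinRoot.root q) * X,
        C (algebraMap (FnField f) (AdjoinRoot q) (toFn f (MvPolynomial.X 2))) +
          C (aeval (AdjoinRoot.root q) (osc f 1)) * X] i).natDegree ≤ 1 := by
  have hC1 : ∀ (a : AdjoinRoot q) (b : Polynomial (AdjoinRoot q)), b.natDegree ≤ 1 →
      (C a + b).natDegree ≤ 1 := fun a b hb =>
    (natDegree_add_le _ _).trans (max_le (by rw [natDegree_C]; exact Nat.zero_le _) hb)
  match i with
  | 0 => exact hC1 _ _ natDegree_X_le
  | 1 => exact hC1 _ _ ((natDegree_C_mul_le _ _).trans natDegree_X_le)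
  | 2 => exact hC1 _ _ ((natDegree_C_mul_le _ _).trans natDegree_X_le)

/-- **The generic flecnodal line lies on the surface.** Let `f` be irreducible of degree `d`
with `∂₂f ∉ (f)` over a field in which `k!`, `k ≤ d`, is invertible (characteristic `0` or
`> d`), and let `q ∈ L[σ]` be irreducible, monic and separable with `q ∣ T₂`, `q ∣ T₃`,
`q ∤ T₂'` (`T_k` the osculating polynomials of `HypersurfaceLineTaylor.lean`). Then, in
`L'[t]` with `L' = L[σ]/(q) ∋ s`:  `f(x̄₀ + t, x̄₁ + s t, z̄ + T₁(s) t) = 0`.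
[cite: Kollar2015, Theorem 13 and §6 (Monge: flecnodal ⟹ ruled; algebraic core), ¶38–39
(characteristic `p > d`)] -/
theorem aeval_flecnodalLine_eq_zero (h2f : toFn f (MvPolynomial.pderiv 2 f) ≠ 0)
    (hfac : ∀ k, k ≤ f.totalDegree → ((k ! : ℕ) : K) ≠ 0)
    (hq2 : q ∣ osc f 2) (hq3 : q ∣ osc f 3) (hnp : ¬ q ∣ derivative (osc f 2)) :
    MvPolynomial.aeval
      ![C (algebraMap (FnField f) (AdjoinRoot q) (toFn f (MvPolynomial.X 0))) + X,
        C (algebraMap (FnField f) (AdjoinRoot q) (toFn f (MvPolynomial.X 1))) +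
          C (AdjoinRoot.root q) * X,
        C (algebraMap (FnField f) (AdjoinRoot q) (toFn f (MvPolynomial.X 2))) +
          C (aeval (AdjoinRoot.root q) (osc f 1)) * X] f = 0 := by
  -- `1 ≤ deg f` (f is not constant)
  have hf : Irreducible f := Fact.out
  have hN1 : 1 ≤ f.totalDegree := by
    by_contra h0
    push Not at h0
    have hfC : f = MvPolynomial.C (MvPolynomial.coeff 0 f) :=
      MvPolynomial.totalDegree_eq_zero_iff_eq_C.1 (by omega)
    refine hf.not_isUnit ?_
    rw [hfC]
    refine MvPolynomial.isUnit_iff_eq_C_of_isReduced.2 ⟨MvPolynomial.coeff 0 f, ?_, rfl⟩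
    exact isUnit_iff_ne_zero.2 fun hc => hf.ne_zero (by rw [hfC, hc, MvPolynomial.C_0])
  -- coefficients `n ≤ deg f` vanish by the Taylor identity, the others by degree
  refine Polynomial.ext fun n => ?_
  rw [coeff_zero]
  by_cases hn : n ≤ f.totalDegree
  · rw [← mapMk_aeval_lineTaylor f q hq2 hq3 hnp f.totalDegree hN1 f, Polynomial.coe_mapRingHom,
      Polynomial.coeff_map, coeff_aeval_lineTaylor_eq_zero h2f hN1 hfac hn, map_zero]
  · push Not at hn
    exact Polynomial.coeff_eq_zero_of_natDegree_lt (lt_of_le_of_lt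
      (natDegree_aeval_le_totalDegree _ (natDegree_flecnodalLine_le f q) f) hn)

end Hypersurface

end Literature.RingTheory.MvPolynomial
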